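/-
Copyright (c) 2026 the pub-hodgecm-mathlib formalisation cell (harness21).  Prover seat hodgecm-mathlib-K2E4-p14 (g6), Track B ∕ K2-LIT, h413 =
`stmt-HodgeConjecture-24833`, line `K2_E1_TraceFormulaBeta`, campaign «EIS-WHITTAKER-2», deck #1a «W2-fin-S» §4 (the instance); dealer K2E1-plan (g4) «split» 2026-09-04T07:41:21Z.
-/
import Summits.HodgeConjecture.HodgeConjecture.Theorems.K2E1FiniteWhittakerStepSymbol        -- ★ (this seat): the generic radial step symbol, §1–§3
import Summits.HodgeConjecture.HodgeConjecture.Theorems.K2E1IntertwiningLocalFactorU2Line    -- ★ p858204 (K2E2-p12 g4): the local factor `P_v`, `continuous_prod_extension_max_one`; (b2) `normAbs_adicCompletionSemialgHom`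
import HarnessLib

/-!
# h413 ∕ Track B «K2-LIT», «EIS-WHITTAKER-2» deck #1a «W2-fin-S» §4 — `K2E1FiniteWhittakerStepSymbolLine`: THE INSTANCE `P_v(t) = ∏_{w∣v} max(1, ‖ι_w t‖_w·‖δ‖_w)` AT A FINITE
# PLACE `v` OF THE BASE OF THE QUADRATIC EXTENSION `E/F` — `∫_{F_v} P_v(t)^{−z} ψ(tξ) dμ` is the finite shell sum of ★ `K2E1FiniteWhittakerStepSymbol`

Cell `pub/hodgecm-mathlib`, crux H413 = `stmt-HodgeConjecture-24833`, route `HCCMUnconditional`; dealer K2E1-plan (g4) (07:35:50Z spec, «split» 07:41:21Z, CONSTANTS-FIRST token: the base ball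
`a` enters as the LETTER `ha : ∀ w, ∀ t ∈ 𝔭^a, ‖ι_w t‖_w·‖δ‖_w ≤ 1`, its existence a separate lemma).  THEOREMS ONLY; lane `--kind proof --supports stmt-HodgeConjecture-24833 --as helper`
(count-neutral).

THE INSTANCE [CasselsFrohlichANT1967, Ch. II §11; Tate1950, §2.5].  `F_v = v.adicCompletion F`, `ι_w : F_v → E_w` for `w ∣ v` (★ FLT packet), `‖δ‖_w = normAbs_w(δ_w)`, and the local factor of
★ p858204 §3, `P_v(t) = ∏_{w∣v} max(1, ‖ι_w t‖_w·‖δ‖_w)`.  §1 ALGEBRA: by ★ (b2) `‖ι_w t‖_w = ‖t‖_v^{e_w f_w}` the symbol is RADIAL, `P_v(t) = Π(‖t‖_v)` with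
`Π(x) := ∏_{w∣v} max(1, x^{e_w f_w}·‖δ‖_w)`; `Π ≥ 1`; `Π(x) ≥ c_δ·max(1,x)²` with **`c_δ := ∏_{w∣v} min(1, ‖δ‖_w) > 0`** (`max(1, yd) ≥ min(1,d)·max(1,y)`, `∏_{w∣v} max(1,x^{e_w f_w}) = max(1,x)^{[E:F]} =
max(1,x)²` ★ `sum_ramification_inertia_extensions`); on the shell `𝔭^{a−k−1} ∖ 𝔭^{a−k}` (`‖t‖_v = q_v^{k+1−a}` ★ `mem_shell_iff`) `P_v(t) = p_k := Π(q_v^{k+1−a})`, with `p_k ≥ c_δ·q_v^{2(k+1−a)}`;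
under the letter `ha`, `P_v = 1` on `𝔭^a` — and such an `a` EXISTS (`exists_baseBall`).  §2 ANALYSIS: `P_v` is continuous ★, `≥ 1`, and for `Re z > ½` the integrand `P_v^{−z}ψ(tξ)` is
integrable on `F_v` by domination `P_v^{−Re z} ≤ c_δ^{−Re z}·max(1,‖t‖)^{−2Re z}` from ★ p858040; hence ★ `K2E1FiniteWhittakerStepSymbol` applies verbatim:
**`∫_{F_v} P_v(t)^{−z} ψ(tξ) dμ = S_v(z)`**, the finite shell sum at `p_k` (`K`-stable, ENTIRE, `‖S_v(z)‖ ≤ (q^{−a} + (2n+1)c_δ^{−1∕2})·μ(𝒪_v)` on `Re z ≥ ½`), and `= 0` for `ξ ∉ 𝔭^{m−a}`.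
HONEST LABEL.  Count-neutral helper; proves no printed statement; HC_CM is proved only modulo the 7 printed citations (2 remaining named inputs: hLiu418 =
`stmt-HodgeConjecture-24832`, h413 = `stmt-HodgeConjecture-24833`) until rung 0 closes.

## References
* [CasselsFrohlichANT1967] J. W. S. Cassels, *Global fields*, Ch. II §11 (normalised valuations in an extension), and J. Tate, Ch. XV §2 (local transforms).
* [Tate1950] J. Tate, thesis, §2.5.
* [JacquetLanglands1970] H. Jacquet, R. P. Langlands, *Automorphic Forms on GL(2)*, §3.
-/

set_option autoImplicit false
set_option linter.dupNamespace false  -- the mandated namespace repeats the summit's segment (`HodgeConjecture.HodgeConjecture`)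

noncomputable section

open MeasureTheory Filter Topology Set NumberField IsDedekindDomain IsDedekindDomain.HeightOneSpectrum
open scoped NNReal ENNReal
open Literature.NumberTheory.GaloisRepresentations.IsNonarchimedeanLocalField
open Literature.NumberTheory.Automorphic Literature.NumberTheory.Automorphic.LocalFieldHaar
open Summit.HodgeConjecture.HodgeConjecture.Cruxes.HLiu418.K2LiuGKRankOneIntegral
open Summit.HodgeConjecture.HodgeConjecture.Cruxes.H413.K2E1IntertwiningLocalFactorU2
open Summit.HodgeConjecture.HodgeConjecture.Cruxes.H413.K2E1IntertwiningLocalFactorU2Height (normAbs_adicCompletionSemialgHom max_one_pow prod_extension_max_one_normAbs)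
open Summit.HodgeConjecture.HodgeConjecture.Cruxes.H413.K2E1IntertwiningLocalFactorU2Line (continuous_prod_extension_max_one)
open Summit.HodgeConjecture.HodgeConjecture.Cruxes.H413.K2E1FiniteWhittakerStepSymbol

namespace Summit.HodgeConjecture.HodgeConjecture.Cruxes.H413.K2E1FiniteWhittakerStepSymbolLine

variable {F E : Type} [Field F] [NumberField F] [Field E] [NumberField E] [Algebra F E] {δ : E} (v : HeightOneSpectrum (𝓞 F))

/-! ## §1 Algebra of the local factor: radial, `≥ 1`, `≥ c_δ·max(1,‖t‖)²`, constant on shells, `= 1` on the base ball -/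

/-- **`Π(x) ≥ 1`** for `Π(x) = ∏_{w∣v} max(1, x^{e_w f_w}·‖δ‖_w)`. [folklore] -/
theorem one_le_prod_max_one (x : ℝ≥0) : 1 ≤ (letI := Extension.fintype (𝓞 F) F E (𝓞 E) v; ∏ w : v.Extension (𝓞 E), max 1 ((x) ^ (w.1.asIdeal.ramificationIdx (𝓞 F) * w.1.asIdeal.inertiaDeg (𝓞 F)) * normAbs (w.1.adicCompletion E) ((algebraMap E (FiniteAdeleRing (𝓞 E) E) δ) w.1))) := by
  letI := Extension.fintype (𝓞 F) F E (𝓞 E) v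
  calc (1 : ℝ≥0) = ∏ _w : v.Extension (𝓞 E), (1 : ℝ≥0) := Finset.prod_const_one.symm
    _ ≤ _ := Finset.prod_le_prod (fun _ _ => zero_le_one) fun w _ => le_max_left _ _

/-- **`c_δ·max(1,x)² ≤ Π(x)`** for a quadratic `E/F`, `c_δ = ∏_{w∣v} min(1,‖δ‖_w)`: termwise `min(1,‖δ‖_w)·max(1,x^{e f}) ≤ max(1, x^{e f}‖δ‖_w)`, `max(1,x^{e f}) = max(1,x)^{e f}` (★ `max_one_pow`) and
`Σ_{w∣v} e_w f_w = [E:F] = 2` (★ `Ideal.sum_ramification_inertia_extensions`). [cite: CasselsFrohlichANT1967, Ch. II §11] -/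
theorem prod_min_one_mul_max_one_sq_le [Algebra.IsQuadraticExtension F E] (x : ℝ≥0) : (letI := Extension.fintype (𝓞 F) F E (𝓞 E) v; ∏ w : v.Extension (𝓞 E), min 1 (normAbs (w.1.adicCompletion E) ((algebraMap E (FiniteAdeleRing (𝓞 E) E) δ) w.1))) * (max 1 x) ^ 2 ≤ (letI := Extension.fintype (𝓞 F) F E (𝓞 E) v; ∏ w : v.Extension (𝓞 E), max 1 ((x) ^ (w.1.asIdeal.ramificationIdx (𝓞 F) * w.1.asIdeal.inertiaDeg (𝓞 F)) * normAbs (w.1.adicCompletion E) ((algebraMap E (FiniteAdeleRing (𝓞 E) E) δ) w.1))) := by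
  letI := Extension.fintype (𝓞 F) F E (𝓞 E) v
  have hprod : ∏ w : v.Extension (𝓞 E), max 1 (x ^ (w.1.asIdeal.ramificationIdx (𝓞 F) * w.1.asIdeal.inertiaDeg (𝓞 F))) = (max 1 x) ^ 2 := by
    simp_rw [max_one_pow]
    rw [Finset.prod_pow_eq_pow_sum, Ideal.sum_ramification_inertia_extensions, Algebra.IsQuadraticExtension.finrank_eq_two F E]
  -- `min(1,d)·max(1,y) ≤ max(1, y·d)` (★ `K2E1IntertwiningLocalFactorIntegrableU2.min_one_mul_max_one_le`, re-derived inline to keep this generic file's import closure small)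
  have hmm : ∀ y d : ℝ≥0, min 1 d * max 1 y ≤ max 1 (y * d) := fun y d => by
    rcases le_total d 1 with hd | hd
    · rw [min_eq_right hd, mul_max_of_nonneg _ _ zero_le, mul_one, mul_comm]
      exact max_le_max hd le_rfl
    · rw [min_eq_left hd, one_mul]
      exact max_le_max le_rfl (le_mul_of_one_le_right zero_le hd)
  rw [← hprod, ← Finset.prod_mul_distrib]
  exact Finset.prod_le_prod (fun _ _ => zero_le) fun w _ => hmm _ _

/-- **THE LOCAL FACTOR IS RADIAL**: `P_v(t) = Π(‖t‖_v)` (★ (b2) `‖ι_w t‖_w = ‖t‖_v^{e_w f_w}`). [cite: CasselsFrohlichANT1967, Ch. II §11] -/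
theorem lineSymbol_eq_prod_normAbs_pow (t : v.adicCompletion F) : (letI := Extension.fintype (𝓞 F) F E (𝓞 E) v; ∏ w : v.Extension (𝓞 E), max 1 (normAbs (w.1.adicCompletion E) (Extension.adicCompletionSemialgHom F E w t) * normAbs (w.1.adicCompletion E) ((algebraMap E (FiniteAdeleRing (𝓞 E) E) δ) w.1))) = (letI := Extension.fintype (𝓞 F) F E (𝓞 E) v; ∏ w : v.Extension (𝓞 E), max 1 ((normAbs (v.adicCompletion F) t) ^ (w.1.asIdeal.ramificationIdx (𝓞 F) * w.1.asIdeal.inertiaDeg (𝓞 F)) * normAbs (w.1.adicCompletion E) ((algebraMap E (FiniteAdeleRing (𝓞 E) E) δ) w.1))) := by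
  letI := Extension.fintype (𝓞 F) F E (𝓞 E) v
  exact Finset.prod_congr rfl fun w _ => by rw [normAbs_adicCompletionSemialgHom F E v w t]

/-- **`P_v ≥ 1`.** [folklore] -/
theorem one_le_lineSymbol (t : v.adicCompletion F) : (1 : ℝ) ≤ (((letI := Extension.fintype (𝓞 F) F E (𝓞 E) v; ∏ w : v.Extension (𝓞 E), max 1 (normAbs (w.1.adicCompletion E) (Extension.adicCompletionSemialgHom F E w t) * normAbs (w.1.adicCompletion E) ((algebraMap E (FiniteAdeleRing (𝓞 E) E) δ) w.1))) : ℝ≥0) : ℝ) := by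
  have h := one_le_prod_max_one (E := E) (δ := δ) v (normAbs (v.adicCompletion F) t)
  rw [← lineSymbol_eq_prod_normAbs_pow v t] at h
  exact_mod_cast h

/-- **`P_v` is continuous** (★ `continuous_prod_extension_max_one`). [cite: CasselsFrohlichANT1967, Ch. II §11] -/
theorem continuous_lineSymbol : Continuous fun t : v.adicCompletion F => (((letI := Extension.fintype (𝓞 F) F E (𝓞 E) v; ∏ w : v.Extension (𝓞 E), max 1 (normAbs (w.1.adicCompletion E) (Extension.adicCompletionSemialgHom F E w t) * normAbs (w.1.adicCompletion E) ((algebraMap E (FiniteAdeleRing (𝓞 E) E) δ) w.1))) : ℝ≥0) : ℝ) :=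
  NNReal.continuous_coe.comp (continuous_prod_extension_max_one (E := E) (δ := δ) v)

/-- **`P_v ≥ c_δ·max(1,‖t‖_v)²`** (`E/F` quadratic). [cite: CasselsFrohlichANT1967, Ch. II §11] -/
theorem prod_min_one_mul_max_one_normAbs_sq_le_lineSymbol [Algebra.IsQuadraticExtension F E] (t : v.adicCompletion F) :
    (letI := Extension.fintype (𝓞 F) F E (𝓞 E) v; ∏ w : v.Extension (𝓞 E), min 1 (normAbs (w.1.adicCompletion E) ((algebraMap E (FiniteAdeleRing (𝓞 E) E) δ) w.1))) * (max 1 (normAbs (v.adicCompletion F) t)) ^ 2 ≤ (letI := Extension.fintype (𝓞 F) F E (𝓞 E) v; ∏ w : v.Extension (𝓞 E), max 1 (normAbs (w.1.adicCompletion E) (Extension.adicCompletionSemialgHom F E w t) * normAbs (w.1.adicCompletion E) ((algebraMap E (FiniteAdeleRing (𝓞 E) E) δ) w.1))) := by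
  rw [lineSymbol_eq_prod_normAbs_pow v t]
  exact prod_min_one_mul_max_one_sq_le v _

/-- **`P_v` IS CONSTANT ON SHELLS**: for `t ∈ 𝔭^{a−k−1} ∖ 𝔭^{a−k}` (`‖t‖_v = q_v^{k+1−a}`, ★ `mem_shell_iff`), `P_v(t) = p_k := Π(q_v^{−(a−k−1)})`. [cite: Tate1950, §2.5] -/
theorem lineSymbol_eq_of_mem_shell {a : ℤ} {k : ℕ} {t : v.adicCompletion F}
    (ht : t ∈ primePowBall (v.adicCompletion F) (a - ((k : ℤ) + 1)) \ primePowBall (v.adicCompletion F) (a - (k : ℤ))) : (((letI := Extension.fintype (𝓞 F) F E (𝓞 E) v; ∏ w : v.Extension (𝓞 E), max 1 (normAbs (w.1.adicCompletion E) (Extension.adicCompletionSemialgHom F E w t) * normAbs (w.1.adicCompletion E) ((algebraMap E (FiniteAdeleRing (𝓞 E) E) δ) w.1))) : ℝ≥0) : ℝ) = (((letI := Extension.fintype (𝓞 F) F E (𝓞 E) v; ∏ w : v.Extension (𝓞 E), max 1 (((residueFieldCard (v.adicCompletion F) : ℝ≥0)⁻¹ ^ (a - ((k : ℤ) + 1)))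 ^ (w.1.asIdeal.ramificationIdx (𝓞 F) * w.1.asIdeal.inertiaDeg (𝓞 F)) * normAbs (w.1.adicCompletion E) ((algebraMap E (FiniteAdeleRing (𝓞 E) E) δ) w.1))) : ℝ≥0) : ℝ) := by
  have ht' : t ∈ primePowBall (v.adicCompletion F) (a - ((k : ℤ) + 1)) \ primePowBall (v.adicCompletion F) (a - ((k : ℤ) + 1) + 1) := by
    rwa [show a - ((k : ℤ) + 1) + 1 = a - (k : ℤ) by ring]
  rw [mem_shell_iff] at ht'
  rw [lineSymbol_eq_prod_normAbs_pow v t, ht']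

/-- **UNDER THE BASE-BALL LETTER `ha`, `P_v = 1` ON `𝔭^a`** (every factor is `max(1, ·) = 1`). [cite: Tate1950, §2.5] -/
theorem lineSymbol_eq_one_of_mem {a : ℤ}
    (ha : ∀ (w : v.Extension (𝓞 E)) (t : v.adicCompletion F), t ∈ primePowBall (v.adicCompletion F) a → normAbs (w.1.adicCompletion E) (Extension.adicCompletionSemialgHom F E w t) * normAbs (w.1.adicCompletion E) ((algebraMap E (FiniteAdeleRing (𝓞 E) E) δ) w.1) ≤ 1)
    (t : v.adicCompletion F) (ht : t ∈ primePowBall (v.adicCompletion F) a) : (((letI := Extension.fintype (𝓞 F) F E (𝓞 E) v; ∏ w : v.Extension (𝓞 E), max 1 (normAbs (w.1.adicCompletion E) (Extension.adicCompletionSemialgHom F E w t) * normAbs (w.1.adicCompletion E) ((algebraMap E (FiniteAdeleRing (𝓞 E) E) δ) w.1))) : ℝ≥0) : ℝ) = 1 := by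
  letI := Extension.fintype (𝓞 F) F E (𝓞 E) v
  have h : (letI := Extension.fintype (𝓞 F) F E (𝓞 E) v; ∏ w : v.Extension (𝓞 E), max 1 (normAbs (w.1.adicCompletion E) (Extension.adicCompletionSemialgHom F E w t) * normAbs (w.1.adicCompletion E) ((algebraMap E (FiniteAdeleRing (𝓞 E) E) δ) w.1))) = 1 := Finset.prod_eq_one fun w _ => max_eq_left (ha w t ht)
  rw [h, NNReal.coe_one]

/-- `e_w f_w ≠ 0`. [folklore] -/
theorem ramificationIdx_mul_inertiaDeg_ne_zero (w : v.Extension (𝓞 E)) : (w.1.asIdeal.ramificationIdx (𝓞 F) * w.1.asIdeal.inertiaDeg (𝓞 F)) ≠ 0 := by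
  have he0 : w.1.asIdeal.ramificationIdx (𝓞 F) ≠ 0 :=
    HeightOneSpectrum.ramificationIdx_ne_zero (𝓞 F) (𝓞 E) (algebraMap_injective_of_field_isFractionRing (𝓞 F) (𝓞 E) F E) w.1
  haveI := w.1.isPrime
  have hf0 : w.1.asIdeal.inertiaDeg (𝓞 F) ≠ 0 := (Ideal.inertiaDeg_pos (R := 𝓞 F) w.1.asIdeal).ne'
  exact mul_ne_zero he0 hf0

/-- **THE BASE BALL EXISTS** (CONSTANTS-FIRST companion of the letter `ha`): some `a` with `‖ι_w t‖_w·‖δ‖_w ≤ 1` for all `w ∣ v` and all `t ∈ 𝔭^a` (`‖ι_w t‖_w = ‖t‖_v^{e f} ≤ q_v^{−a}` for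
`a ≥ 0`, and `q_v^{−N}·(1 + Σ_w ‖δ‖_w) ≤ 1` for `N` large, ★ `inv_residueFieldCard_lt_one`). [cite: CasselsFrohlichANT1967, Ch. II §11] -/
theorem exists_baseBall : ∃ a : ℤ, ∀ (w : v.Extension (𝓞 E)) (t : v.adicCompletion F), t ∈ primePowBall (v.adicCompletion F) a →
    normAbs (w.1.adicCompletion E) (Extension.adicCompletionSemialgHom F E w t) * normAbs (w.1.adicCompletion E) ((algebraMap E (FiniteAdeleRing (𝓞 E) E) δ) w.1) ≤ 1 := by
  letI := Extension.fintype (𝓞 F) F E (𝓞 E) v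
  set D : ℝ≥0 := 1 + ∑ w : v.Extension (𝓞 E), normAbs (w.1.adicCompletion E) ((algebraMap E (FiniteAdeleRing (𝓞 E) E) δ) w.1) with hD
  have hDw : ∀ w : v.Extension (𝓞 E), normAbs (w.1.adicCompletion E) ((algebraMap E (FiniteAdeleRing (𝓞 E) E) δ) w.1) ≤ D := fun w =>
    (Finset.single_le_sum (f := fun w : v.Extension (𝓞 E) => normAbs (w.1.adicCompletion E) ((algebraMap E (FiniteAdeleRing (𝓞 E) E) δ) w.1)) (fun _ _ => zero_le) (Finset.mem_univ w)).trans le_add_self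
  have hD1 : 1 ≤ D := le_self_add
  have hD0 : 0 < D := one_pos.trans_le hD1
  have hq : (residueFieldCard (v.adicCompletion F) : ℝ≥0)⁻¹ < 1 := inv_residueFieldCard_lt_one
  obtain ⟨N, hN⟩ := exists_pow_lt_of_lt_one (inv_pos.2 hD0) hq
  refine ⟨N, fun w t ht => ?_⟩
  rw [mem_primePowBall_iff, zpow_natCast] at ht
  have h1 : normAbs (w.1.adicCompletion E) (Extension.adicCompletionSemialgHom F E w t) ≤ (residueFieldCard (v.adicCompletion F) : ℝ≥0)⁻¹ ^ N := by
    rw [normAbs_adicCompletionSemialgHom F E v w t]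
    exact (pow_le_pow_left₀ zero_le ht _).trans (pow_le_of_le_one zero_le (pow_le_one₀ zero_le hq.le) (ramificationIdx_mul_inertiaDeg_ne_zero v w))
  calc normAbs (w.1.adicCompletion E) (Extension.adicCompletionSemialgHom F E w t) * normAbs (w.1.adicCompletion E) ((algebraMap E (FiniteAdeleRing (𝓞 E) E) δ) w.1) ≤ (residueFieldCard (v.adicCompletion F) : ℝ≥0)⁻¹ ^ N * D :=
        mul_le_mul h1 (hDw w) zero_le zero_le
    _ ≤ D⁻¹ * D := mul_le_mul hN.le le_rfl zero_le zero_le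
    _ = 1 := inv_mul_cancel₀ hD0.ne'

/-- **`c_δ > 0`** for `δ ≠ 0`: every `‖δ‖_w > 0` (`δ_w·(δ⁻¹)_w = 1` in `E_w`). [folklore] -/
theorem prod_min_one_pos (hδ : δ ≠ 0) : 0 < (letI := Extension.fintype (𝓞 F) F E (𝓞 E) v; ∏ w : v.Extension (𝓞 E), min 1 (normAbs (w.1.adicCompletion E) ((algebraMap E (FiniteAdeleRing (𝓞 E) E) δ) w.1))) := by
  letI := Extension.fintype (𝓞 F) F E (𝓞 E) v
  refine Finset.prod_pos fun w _ => lt_min one_pos ?_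
  have hne : (algebraMap E (FiniteAdeleRing (𝓞 E) E) δ) w.1 ≠ 0 := by
    intro h0
    have h1 : (algebraMap E (FiniteAdeleRing (𝓞 E) E) δ) w.1 * (algebraMap E (FiniteAdeleRing (𝓞 E) E) δ⁻¹) w.1 = 1 := by
      change (algebraMap E (FiniteAdeleRing (𝓞 E) E) δ * algebraMap E (FiniteAdeleRing (𝓞 E) E) δ⁻¹) w.1 = 1
      rw [← map_mul, mul_inv_cancel₀ hδ, map_one]
      rfl
    rw [h0, zero_mul] at h1
    exact zero_ne_one h1
  exact pos_iff_ne_zero.2 ((map_ne_zero _).2 hne)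

/-- **GROWTH OF THE SHELL VALUES**: `c_δ·q_v^{2(k+1−a)} ≤ p_k` (`p_k = Π(q_v^{k+1−a}) ≥ c_δ·max(1, q_v^{k+1−a})² ≥ c_δ·q_v^{2(k+1−a)}`) — the letter `hc` of ★ `norm_shellSum_le_linear`.
[cite: JacquetLanglands1970, §3] -/
theorem prod_min_one_mul_zpow_le_shellValue [Algebra.IsQuadraticExtension F E] (a : ℤ) (k : ℕ) :
    (((letI := Extension.fintype (𝓞 F) F E (𝓞 E) v; ∏ w : v.Extension (𝓞 E), min 1 (normAbs (w.1.adicCompletion E) ((algebraMap E (FiniteAdeleRing (𝓞 E) E) δ) w.1))) : ℝ≥0) : ℝ) * (residueFieldCard (v.adicCompletion F) : ℝ) ^ (2 * (((k : ℤ) + 1) - a)) ≤ (((letI := Extension.fintype (𝓞 F) F E (𝓞 E) v; ∏ w : v.Extension (𝓞 E), max 1 (((residueFieldCard (v.adicCompletion F) : ℝ≥0)⁻¹ ^ (a - ((k : ℤ) + 1))) ^ (w.1.asIdeal.ramificationIdx (𝓞 F) * w.1.asIdeal.inertiaDeg (𝓞 F)) * normAbs (w.1.adicCompletion E) ((algebraMap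 E (FiniteAdeleRing (𝓞 E) E) δ) w.1))) : ℝ≥0) : ℝ) := by
  have h := prod_min_one_mul_max_one_sq_le (E := E) (δ := δ) v ((residueFieldCard (v.adicCompletion F) : ℝ≥0)⁻¹ ^ (a - ((k : ℤ) + 1)))
  have hx : ((residueFieldCard (v.adicCompletion F) : ℝ≥0)⁻¹ ^ (a - ((k : ℤ) + 1))) ^ 2 ≤ (max 1 ((residueFieldCard (v.adicCompletion F) : ℝ≥0)⁻¹ ^ (a - ((k : ℤ) + 1)))) ^ 2 :=
    pow_le_pow_left₀ zero_le (le_max_right _ _) 2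
  have h' := (mul_le_mul_of_nonneg_left hx zero_le).trans h
  have hq : ((((residueFieldCard (v.adicCompletion F) : ℝ≥0)⁻¹ ^ (a - ((k : ℤ) + 1))) ^ 2 : ℝ≥0) : ℝ) = (residueFieldCard (v.adicCompletion F) : ℝ) ^ (2 * (((k : ℤ) + 1) - a)) := by
    rw [NNReal.coe_pow, NNReal.coe_zpow, NNReal.coe_inv, NNReal.coe_natCast, inv_zpow', ← zpow_natCast, ← zpow_mul]
    congr 1
    push_cast
    ring
  have h'' := NNReal.coe_le_coe.2 h'
  rw [NNReal.coe_mul, hq] at h''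
  exact h''

/-! ## §2 The Whittaker integral of the local factor: integrable for `Re z > ½`, equal to the finite shell sum, entire, bounded, vanishing below the threshold -/

section Integral

variable [MeasurableSpace (v.adicCompletion F)] [BorelSpace (v.adicCompletion F)] (μ : Measure (v.adicCompletion F)) [μ.IsAddHaarMeasure]

/-- **Integrability for `Re z > ½`** by domination: `|P_v(t)^{−z}| = P_v(t)^{−Re z} ≤ c_δ^{−Re z}·max(1,‖t‖)^{−2Re z}` and ★ p858040 `integrable_and_integral_max_one_normAbs_cpow_two_mul`.
[cite: Casselman1980, §3] -/
theorem integrable_lineSymbol_mul_addChar [Algebra.IsQuadraticExtension F E] (hδ : δ ≠ 0) {ψ : AddChar (v.adicCompletion F) Circle} (hψ : Continuous ψ)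
    (ξ : v.adicCompletion F) {z : ℂ} (hz : 1 / 2 < z.re) :
    Integrable (fun t : v.adicCompletion F => ((((((letI := Extension.fintype (𝓞 F) F E (𝓞 E) v; ∏ w : v.Extension (𝓞 E), max 1 (normAbs (w.1.adicCompletion E) (Extension.adicCompletionSemialgHom F E w t) * normAbs (w.1.adicCompletion E) ((algebraMap E (FiniteAdeleRing (𝓞 E) E) δ) w.1))) : ℝ≥0) : ℝ) : ℝ) : ℂ) ^ (-z)) * ((ψ (t * ξ) : Circle) : ℂ)) μ := by
  have hc0 : (0 : ℝ) < (((letI := Extension.fintype (𝓞 F) F E (𝓞 E) v; ∏ w : v.Extension (𝓞 E), min 1 (normAbs (w.1.adicCompletion E) ((algebraMap E (FiniteAdeleRing (𝓞 E) E) δ) w.1))) : ℝ≥0) : ℝ) := by exact_mod_cast prod_min_one_pos v hδ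
  have hmaj := (integrable_and_integral_max_one_normAbs_cpow_two_mul μ hz).1
  refine Integrable.mono' ((hmaj.norm).const_mul (((((letI := Extension.fintype (𝓞 F) F E (𝓞 E) v; ∏ w : v.Extension (𝓞 E), min 1 (normAbs (w.1.adicCompletion E) ((algebraMap E (FiniteAdeleRing (𝓞 E) E) δ) w.1))) : ℝ≥0) : ℝ)) ^ (-z.re))) ?_ (Eventually.of_forall fun t => ?_)
  · exact (((Complex.continuous_ofReal.comp (continuous_lineSymbol (E := E) (δ := δ) v)).cpow continuous_const fun t =>
      Complex.ofReal_mem_slitPlane.2 (lt_of_lt_of_le one_pos (one_le_lineSymbol (E := E) (δ := δ) v t))).mul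
      (continuous_subtype_val.comp (hψ.comp (continuous_id.mul continuous_const)))).aestronglyMeasurable
  · have hP : (0 : ℝ) < (((letI := Extension.fintype (𝓞 F) F E (𝓞 E) v; ∏ w : v.Extension (𝓞 E), max 1 (normAbs (w.1.adicCompletion E) (Extension.adicCompletionSemialgHom F E w t) * normAbs (w.1.adicCompletion E) ((algebraMap E (FiniteAdeleRing (𝓞 E) E) δ) w.1))) : ℝ≥0) : ℝ) := lt_of_lt_of_le one_pos (one_le_lineSymbol v t)
    have hm : (0 : ℝ) < max 1 ((normAbs (v.adicCompletion F) t : ℝ≥0) : ℝ) := lt_of_lt_of_le one_pos (le_max_left _ _)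
    have hre : (-(2 * z)).re = 2 * -z.re := by
      simp only [Complex.neg_re, Complex.mul_re, Complex.re_ofNat, Complex.im_ofNat, zero_mul, sub_zero]
      ring
    have hgrowth : (((letI := Extension.fintype (𝓞 F) F E (𝓞 E) v; ∏ w : v.Extension (𝓞 E), min 1 (normAbs (w.1.adicCompletion E) ((algebraMap E (FiniteAdeleRing (𝓞 E) E) δ) w.1))) : ℝ≥0) : ℝ) * (max 1 ((normAbs (v.adicCompletion F) t : ℝ≥0) : ℝ)) ^ 2 ≤ (((letI := Extension.fintype (𝓞 F) F E (𝓞 E) v; ∏ w : v.Extension (𝓞 E), max 1 (normAbs (w.1.adicCompletion E) (Extension.adicCompletionSemialgHom F E w t) * normAbs (w.1.adicCompletion E) ((algebraMap E (FiniteAdeleRing (𝓞 E) E) δ) w.1))) : ℝ≥0) : ℝ) := by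
      have h := NNReal.coe_le_coe.2 (prod_min_one_mul_max_one_normAbs_sq_le_lineSymbol (E := E) (δ := δ) v t)
      rwa [NNReal.coe_mul, NNReal.coe_pow, NNReal.coe_max, NNReal.coe_one] at h
    rw [norm_mul, Circle.norm_coe, mul_one, Complex.norm_cpow_eq_rpow_re_of_pos hP, Complex.neg_re, Complex.norm_cpow_eq_rpow_re_of_pos hm, hre,
      Real.rpow_mul hm.le, Real.rpow_two, ← Real.mul_rpow hc0.le (sq_nonneg _)]
    exact Real.rpow_le_rpow_of_nonpos (mul_pos hc0 (pow_pos hm 2)) hgrowth (by linarith)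

/-- **«W2-fin-S» AT `v ∈ S_δ`: THE WHITTAKER INTEGRAL OF THE LOCAL FACTOR IS THE FINITE SHELL SUM** — for `δ ≠ 0`, the base-ball letter `ha`, `ψ` continuous of conductor exponent `m`,
`ξ ∈ 𝔭^{m−a+n} ∖ 𝔭^{m−a+n+1}` and `Re z > ½`:
`∫_{F_v} P_v(t)^{−z} ψ(tξ) dμ(t) = μ(𝔭^a) + Σ_{k<n} p_k^{−z}(μ(𝔭^{a−k−1}) − μ(𝔭^{a−k})) − p_n^{−z}·μ(𝔭^{a−n})`, `p_k = Π(q_v^{−(a−k−1)})` (★ `integral_stepSymbol_mul_addChar_eq_shellSum`).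
[cite: Tate1950, §2.5] [cite: JacquetLanglands1970, §3] -/
theorem integral_lineSymbol_mul_addChar_eq_shellSum [Algebra.IsQuadraticExtension F E] (hδ : δ ≠ 0) {a : ℤ}
    (ha : ∀ (w : v.Extension (𝓞 E)) (t : v.adicCompletion F), t ∈ primePowBall (v.adicCompletion F) a → normAbs (w.1.adicCompletion E) (Extension.adicCompletionSemialgHom F E w t) * normAbs (w.1.adicCompletion E) ((algebraMap E (FiniteAdeleRing (𝓞 E) E) δ) w.1) ≤ 1)
    {ψ : AddChar (v.adicCompletion F) Circle} (hψ : Continuous ψ) {m : ℤ} (hm : ψ.HasConductorExp m)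
    {ξ : v.adicCompletion F} {n : ℕ} (hn : ξ ∈ primePowBall (v.adicCompletion F) (m - a + n)) (hn' : ξ ∉ primePowBall (v.adicCompletion F) (m - a + n + 1)) {z : ℂ} (hz : 1 / 2 < z.re) :
    ∫ t, ((((((letI := Extension.fintype (𝓞 F) F E (𝓞 E) v; ∏ w : v.Extension (𝓞 E), max 1 (normAbs (w.1.adicCompletion E) (Extension.adicCompletionSemialgHom F E w t) * normAbs (w.1.adicCompletion E) ((algebraMap E (FiniteAdeleRing (𝓞 E) E) δ) w.1))) : ℝ≥0) : ℝ) : ℝ) : ℂ) ^ (-z)) * ((ψ (t * ξ) : Circle) : ℂ) ∂μ =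
      (μ.real (primePowBall (v.adicCompletion F) a) : ℂ) +
        (∑ k ∈ Finset.range n, (((((letI := Extension.fintype (𝓞 F) F E (𝓞 E) v; ∏ w : v.Extension (𝓞 E), max 1 (((residueFieldCard (v.adicCompletion F) : ℝ≥0)⁻¹ ^ (a - ((k : ℤ) + 1))) ^ (w.1.asIdeal.ramificationIdx (𝓞 F) * w.1.asIdeal.inertiaDeg (𝓞 F)) * normAbs (w.1.adicCompletion E) ((algebraMap E (FiniteAdeleRing (𝓞 E) E) δ) w.1))) : ℝ≥0) : ℝ) : ℝ) : ℂ) ^ (-z) *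
          ((μ.real (primePowBall (v.adicCompletion F) (a - ((k : ℤ) + 1))) : ℂ) - (μ.real (primePowBall (v.adicCompletion F) (a - (k : ℤ))) : ℂ))) -
        (((((letI := Extension.fintype (𝓞 F) F E (𝓞 E) v; ∏ w : v.Extension (𝓞 E), max 1 (((residueFieldCard (v.adicCompletion F) : ℝ≥0)⁻¹ ^ (a - ((n : ℤ) + 1))) ^ (w.1.asIdeal.ramificationIdx (𝓞 F) * w.1.asIdeal.inertiaDeg (𝓞 F)) * normAbs (w.1.adicCompletion E) ((algebraMap E (FiniteAdeleRing (𝓞 E) E) δ) w.1))) : ℝ≥0) : ℝ) : ℝ) : ℂ) ^ (-z) * (μ.real (primePowBall (v.adicCompletion F) (a - (n : ℤ))) : ℂ) :=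
  integral_stepSymbol_mul_addChar_eq_shellSum μ (continuous_lineSymbol (E := E) (δ := δ) v) (one_le_lineSymbol v) (lineSymbol_eq_one_of_mem v ha)
    (p := fun k : ℕ => (((letI := Extension.fintype (𝓞 F) F E (𝓞 E) v; ∏ w : v.Extension (𝓞 E), max 1 (((residueFieldCard (v.adicCompletion F) : ℝ≥0)⁻¹ ^ (a - ((k : ℤ) + 1))) ^ (w.1.asIdeal.ramificationIdx (𝓞 F) * w.1.asIdeal.inertiaDeg (𝓞 F)) * normAbs (w.1.adicCompletion E) ((algebraMap E (FiniteAdeleRing (𝓞 E) E) δ) w.1))) : ℝ≥0) : ℝ)) (fun _ _ ht => lineSymbol_eq_of_mem_shell v ht) hψ hm hn hn' (integrable_lineSymbol_mul_addChar v μ hδ hψ ξ hz)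

/-- **VANISHING BELOW THE CONDUCTOR-SHIFTED THRESHOLD**: if `ξ ∉ 𝔭^{m−a}` then `∫_{F_v} P_v(t)^{−z} ψ(tξ) dμ(t) = 0` (`Re z > ½`). [cite: Tate1950, §2.5] -/
theorem integral_lineSymbol_mul_addChar_eq_zero_of_not_mem [Algebra.IsQuadraticExtension F E] (hδ : δ ≠ 0) {a : ℤ}
    (ha : ∀ (w : v.Extension (𝓞 E)) (t : v.adicCompletion F), t ∈ primePowBall (v.adicCompletion F) a → normAbs (w.1.adicCompletion E) (Extension.adicCompletionSemialgHom F E w t) * normAbs (w.1.adicCompletion E) ((algebraMap E (FiniteAdeleRing (𝓞 E) E) δ) w.1) ≤ 1)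
    {ψ : AddChar (v.adicCompletion F) Circle} (hψ : Continuous ψ) {m : ℤ} (hm : ψ.HasConductorExp m)
    {ξ : v.adicCompletion F} (hξ : ξ ∉ primePowBall (v.adicCompletion F) (m - a)) {z : ℂ} (hz : 1 / 2 < z.re) :
    ∫ t, ((((((letI := Extension.fintype (𝓞 F) F E (𝓞 E) v; ∏ w : v.Extension (𝓞 E), max 1 (normAbs (w.1.adicCompletion E) (Extension.adicCompletionSemialgHom F E w t) * normAbs (w.1.adicCompletion E) ((algebraMap E (FiniteAdeleRing (𝓞 E) E) δ) w.1))) : ℝ≥0) : ℝ) : ℝ) : ℂ) ^ (-z)) * ((ψ (t * ξ) : Circle) : ℂ) ∂μ = 0 :=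
  integral_stepSymbol_mul_addChar_eq_zero_of_not_mem μ (continuous_lineSymbol (E := E) (δ := δ) v) (one_le_lineSymbol v) (lineSymbol_eq_one_of_mem v ha)
    (p := fun k : ℕ => (((letI := Extension.fintype (𝓞 F) F E (𝓞 E) v; ∏ w : v.Extension (𝓞 E), max 1 (((residueFieldCard (v.adicCompletion F) : ℝ≥0)⁻¹ ^ (a - ((k : ℤ) + 1))) ^ (w.1.asIdeal.ramificationIdx (𝓞 F) * w.1.asIdeal.inertiaDeg (𝓞 F)) * normAbs (w.1.adicCompletion E) ((algebraMap E (FiniteAdeleRing (𝓞 E) E) δ) w.1))) : ℝ≥0) : ℝ)) (fun _ _ ht => lineSymbol_eq_of_mem_shell v ht) hψ hm hξ (integrable_lineSymbol_mul_addChar v μ hδ hψ ξ hz)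

omit [BorelSpace (v.adicCompletion F)] [μ.IsAddHaarMeasure] in
/-- **The shell sum at `v` is ENTIRE in `z`** (★ `differentiable_shellSum`, `p_k ≥ 1`). -/
theorem differentiable_lineShellSum (a : ℤ) (n : ℕ) :
    Differentiable ℂ fun z : ℂ => (μ.real (primePowBall (v.adicCompletion F) a) : ℂ) +
        (∑ k ∈ Finset.range n, (((((letI := Extension.fintype (𝓞 F) F E (𝓞 E) v; ∏ w : v.Extension (𝓞 E), max 1 (((residueFieldCard (v.adicCompletion F) : ℝ≥0)⁻¹ ^ (a - ((k : ℤ) + 1))) ^ (w.1.asIdeal.ramificationIdx (𝓞 F) * w.1.asIdeal.inertiaDeg (𝓞 F)) * normAbs (w.1.adicCompletion E) ((algebraMap E (FiniteAdeleRing (𝓞 E) E) δ) w.1))) : ℝ≥0) : ℝ) : ℝ) : ℂ) ^ (-z) *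
          ((μ.real (primePowBall (v.adicCompletion F) (a - ((k : ℤ) + 1))) : ℂ) - (μ.real (primePowBall (v.adicCompletion F) (a - (k : ℤ))) : ℂ))) -
        (((((letI := Extension.fintype (𝓞 F) F E (𝓞 E) v; ∏ w : v.Extension (𝓞 E), max 1 (((residueFieldCard (v.adicCompletion F) : ℝ≥0)⁻¹ ^ (a - ((n : ℤ) + 1))) ^ (w.1.asIdeal.ramificationIdx (𝓞 F) * w.1.asIdeal.inertiaDeg (𝓞 F)) * normAbs (w.1.adicCompletion E) ((algebraMap E (FiniteAdeleRing (𝓞 E) E) δ) w.1))) : ℝ≥0) : ℝ) : ℝ) : ℂ) ^ (-z) * (μ.real (primePowBall (v.adicCompletion F) (a - (n : ℤ))) : ℂ) :=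
  differentiable_shellSum (p := fun k : ℕ => (((letI := Extension.fintype (𝓞 F) F E (𝓞 E) v; ∏ w : v.Extension (𝓞 E), max 1 (((residueFieldCard (v.adicCompletion F) : ℝ≥0)⁻¹ ^ (a - ((k : ℤ) + 1))) ^ (w.1.asIdeal.ramificationIdx (𝓞 F) * w.1.asIdeal.inertiaDeg (𝓞 F)) * normAbs (w.1.adicCompletion E) ((algebraMap E (FiniteAdeleRing (𝓞 E) E) δ) w.1))) : ℝ≥0) : ℝ)) (fun k => by exact_mod_cast one_le_prod_max_one (E := E) (δ := δ) v _) _ _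
    (fun k => (μ.real (primePowBall (v.adicCompletion F) (a - ((k : ℤ) + 1))) : ℂ)) (fun k => (μ.real (primePowBall (v.adicCompletion F) (a - (k : ℤ))) : ℂ)) n

/-- **The bound on `Re z ≥ ½`, LINEAR in `n`**: `‖S_v(z)‖ ≤ (q_v^{−a} + (2n + 1)·c_δ^{−1∕2})·μ(𝒪_v)` (★ `norm_shellSum_le_linear` with the growth of §1). [cite: JacquetLanglands1970, §3] -/
theorem norm_lineShellSum_le_linear [Algebra.IsQuadraticExtension F E] (hδ : δ ≠ 0) (a : ℤ) (n : ℕ) {z : ℂ} (hz : 1 / 2 ≤ z.re) :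
    ‖(μ.real (primePowBall (v.adicCompletion F) a) : ℂ) +
        (∑ k ∈ Finset.range n, (((((letI := Extension.fintype (𝓞 F) F E (𝓞 E) v; ∏ w : v.Extension (𝓞 E), max 1 (((residueFieldCard (v.adicCompletion F) : ℝ≥0)⁻¹ ^ (a - ((k : ℤ) + 1))) ^ (w.1.asIdeal.ramificationIdx (𝓞 F) * w.1.asIdeal.inertiaDeg (𝓞 F)) * normAbs (w.1.adicCompletion E) ((algebraMap E (FiniteAdeleRing (𝓞 E) E) δ) w.1))) : ℝ≥0) : ℝ) : ℝ) : ℂ) ^ (-z) *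
          ((μ.real (primePowBall (v.adicCompletion F) (a - ((k : ℤ) + 1))) : ℂ) - (μ.real (primePowBall (v.adicCompletion F) (a - (k : ℤ))) : ℂ))) -
        (((((letI := Extension.fintype (𝓞 F) F E (𝓞 E) v; ∏ w : v.Extension (𝓞 E), max 1 (((residueFieldCard (v.adicCompletion F) : ℝ≥0)⁻¹ ^ (a - ((n : ℤ) + 1))) ^ (w.1.asIdeal.ramificationIdx (𝓞 F) * w.1.asIdeal.inertiaDeg (𝓞 F)) * normAbs (w.1.adicCompletion E) ((algebraMap E (FiniteAdeleRing (𝓞 E) E) δ) w.1))) : ℝ≥0) : ℝ) : ℝ) : ℂ) ^ (-z) * (μ.real (primePowBall (v.adicCompletion F) (a - (n : ℤ))) : ℂ)‖ ≤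
      ((residueFieldCard (v.adicCompletion F) : ℝ) ^ (-a) + (2 * n + 1) * ((((letI := Extension.fintype (𝓞 F) F E (𝓞 E) v; ∏ w : v.Extension (𝓞 E), min 1 (normAbs (w.1.adicCompletion E) ((algebraMap E (FiniteAdeleRing (𝓞 E) E) δ) w.1))) : ℝ≥0) : ℝ)) ^ (-(1 / 2 : ℝ))) * μ.real (primePowBall (v.adicCompletion F) 0) :=
  norm_shellSum_le_linear μ (p := fun k : ℕ => (((letI := Extension.fintype (𝓞 F) F E (𝓞 E) v; ∏ w : v.Extension (𝓞 E), max 1 (((residueFieldCard (v.adicCompletion F) : ℝ≥0)⁻¹ ^ (a - ((k : ℤ) + 1))) ^ (w.1.asIdeal.ramificationIdx (𝓞 F) * w.1.asIdeal.inertiaDeg (𝓞 F)) * normAbs (w.1.adicCompletion E) ((algebraMap E (FiniteAdeleRing (𝓞 E) E) δ) w.1))) : ℝ≥0) : ℝ)) (fun k => by exact_mod_cast one_le_prod_max_one (E := E) (δ := δ) v _) a n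
    (by exact_mod_cast prod_min_one_pos v hδ) (prod_min_one_mul_zpow_le_shellValue v a) hz

end Integral

end Summit.HodgeConjecture.HodgeConjecture.Cruxes.H413.K2E1FiniteWhittakerStepSymbolLine

end
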